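import Summits.BirchSwinnertonDyer.Rank1Residual.Additive.UnramifiedKummerDisjoint
import Summits.BirchSwinnertonDyer.Rank1Residual.Additive.InertialTorsionAdditive
import Summits.BirchSwinnertonDyer.Rank1Residual.Additive.TamagawaLocalTorsion
import HarnessLib

/-!
# THE ADDITIVE TAMAGAWA WITNESS: at an additive place `v ∤ p` (`p` odd) with `p ∣ c_v`, an
# unramified class of `H¹(K_v, E[p])` outside the local Kummer image
# (cell `b2b-bsdres`, team n1011, seat p06 GEN 4; OWNERS row T-E3g-ADD, FILE D — assembly)

HONEST FRAMING (cell `b2b-bsdres`, run/shared/lean/b2b/bsd-rank1-residual/, verbatim in every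
file): the goal of the cell is to DELETE the COMBINATION-SHAPED residual classes of the
Birch–Swinnerton-Dyer formula for ALL analytic-rank `≤ 1` elliptic curves over `ℚ` — "full BSD
formula for every rank `≤ 1` curve in class `C`" assembled STRICTLY from published theorems — so
that the rank-`≤ 1` remainder becomes exactly the CONSTRUCTION-SHAPED classes, which are TYPED
(missing-input `Prop`s), NOT attempted. This is not "finishing BSD". Team n1011 (N10/N11: X4 ∧
`p = 3`): research routes on CONSTRUCTION-SHAPED classes; census output = EVIDENCE / conjecture
items, never a Literature fact; RESIDUAL-MAP marks UNCHANGED; nothing is booked by this file.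
THEOREMS ONLY: no definition, no named fact, nothing asserted.

## What (row T-E3g-ADD = r2 II.17 ST-17.3 "ADD-loc"; consumer: p10's T-E3g-BUD0 FILE 4 / BUDn)

The per-prime witness `∃ u ∈ H¹_ur(K_v, E[p]), u ∉ 𝓚_v` of the relaxed-Kummer count, at the
ADDITIVE Tamagawa places: for an elliptic curve `E` over ANY number field `K`, an odd prime `p`,
and a finite place `v ∤ p` of additive reduction with `p ∣ c_v` (Kodaira–Néron forces `p = 3`,
`c_v = 3`, type IV or IV*), assembled from

* FILE A `UnramifiedKummerDisjoint`: `H¹_ur ⊓ 𝓚_v = ⊥` and the witness, given `hI` and a nonzero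
  `T ∈ E(K_v)[p]`;
* FILE B `InertialTorsionAdditive`: `hI` — `E(K_v^nr)[p^∞]` is killed by `p` — at additive
  `v ∤ p`, `p` odd (Kodaira–Néron over `K_v^nr`, `#E(K_v^nr)/E₀(K_v^nr) ≤ 4`);
* FILE C `TamagawaLocalTorsion`: `p ∣ c_v`, `v ∤ p ⟹` a nonzero `T ∈ E(K_v)[p]`.

Also recorded: at EVERY additive `v ∤ p` (`p` odd, no Tamagawa hypothesis) `H¹_ur ⊓ 𝓚_v = ⊥` and
`[H¹_ur ⊔ 𝓚_v : 𝓚_v] = #E[p]^{Γ_{K_v}} = #E(K_v)[p]` — the exact local factor of the count.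

References: R. Greenberg, LNM 1716 (1999) §2, p. 74 [GreenbergLNM1716]; J. S. Milne, *ADT* (2006)
I §2–3 [MilneADT2006]; J. H. Silverman, *AEC* Thm. VII.6.1, Prop. VII.6.3 [SilvermanAEC2009];
ROUTE-2 II.17.3 D-n.3 / ST-17.3 (cells/n1011/).
-/

set_option autoImplicit false

noncomputable section

open scoped Classical

open NumberField IsDedekindDomain Field
open Literature.NumberTheory.EllipticCurves Literature.NumberTheory.GaloisRepresentations
  Literature.NumberTheory.GaloisRepresentations.IsNonarchimedeanLocalField
open Summit.BirchSwinnertonDyer.Rank1Residual.X11b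

namespace Summit.BirchSwinnertonDyer.Rank1Residual.Additive

universe u

variable {K : Type u} [Field K] [NumberField K] (W : WeierstrassCurve K) [W.IsElliptic] (p : ℕ)
  [hp : Fact p.Prime] (v : HeightOneSpectrum (𝓞 K))

/-- **`H¹_ur(K_v, E[p]) ⊓ 𝓚_v = ⊥` at every ADDITIVE place `v ∤ p`, `p` odd** (FILE A §3 with
FILE B's `hI`). [cite: GreenbergLNM1716, §2, p. 74] [cite: SilvermanAEC2009, Thm. VII.6.1] -/
theorem unramifiedSubgroup_inf_kummerLocalConditionAt_eq_bot_of_hasAdditiveReductionAt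
    (hpv : ((p : ℕ) : 𝓞 K) ∉ v.asIdeal) (hp2 : p ≠ 2) (hadd : W.HasAdditiveReductionAt v) :
    DiscreteGaloisModule.unramifiedSubgroup
        (GaloisRep.restrictField (v.adicCompletion K) (W.torsionGaloisModule (p : ℤ))) 1 ⊓
      W.kummerLocalConditionAt (p : ℤ) (v.adicCompletion K) = ⊥ :=
  unramifiedSubgroup_inf_kummerLocalConditionAt_eq_bot_of_inertia_torsion W p v hpv
    (inertia_torsion_of_hasAdditiveReductionAt W p v hpv hp2 hadd)

/-- **The exact local factor at an additive place: `[H¹_ur ⊔ 𝓚_v : 𝓚_v] = #E[p]^{Γ_{K_v}}`** for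
every additive `v ∤ p`, `p` odd (`= #E(K_v)[p]`, i.e. `p` exactly at the additive Tamagawa places
IV / IV* with `c_v = 3 = p`, and `1` at the other additive places).
[cite: MilneADT2006, Ch. I, Lemma 2.9 and §3 Prop. 3.8] [cite: SilvermanAEC2009, Thm. VII.6.1] -/
theorem relIndex_kummerLocalConditionAt_sup_unramifiedSubgroup_of_hasAdditiveReductionAt
    (hpv : ((p : ℕ) : 𝓞 K) ∉ v.asIdeal) (hp2 : p ≠ 2) (hadd : W.HasAdditiveReductionAt v) :
    (W.kummerLocalConditionAt (p : ℤ) (v.adicCompletion K)).relIndex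
        (DiscreteGaloisModule.unramifiedSubgroup
            (GaloisRep.restrictField (v.adicCompletion K) (W.torsionGaloisModule (p : ℤ))) 1 ⊔
          W.kummerLocalConditionAt (p : ℤ) (v.adicCompletion K)) =
      Nat.card (GaloisRep.restrictField (v.adicCompletion K)
        (W.torsionGaloisModule (p : ℤ))).toTopRep.ρ.invariants :=
  relIndex_kummerLocalConditionAt_sup_unramifiedSubgroup_of_inertia_torsion W p v hpv
    (inertia_torsion_of_hasAdditiveReductionAt W p v hpv hp2 hadd)

/-- **The witness from ANY nonzero `p`-torsion point of `E(K_v)` at an additive place** (`v ∤ p`,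
`p` odd; no Tamagawa hypothesis): FILE A's `…_of_point` with `hI` discharged by FILE B. This is the
form the LEVEL-`n` door consumes at a place `w ∣ ℓ` of `ℚ_n` (T-E3g-BUDn): additive reduction
persists in the unramified layer (`hasAdditiveReductionAt_baseChange_of_ramificationIdxIn_eq_one`)
and a nonzero `3`-torsion point of `E(ℚ_ℓ)` (FILE C from `3 ∣ c_ℓ` over `ℚ`) stays a nonzero
`3`-torsion point of `E((ℚ_n)_w)` — so NO persistence of the Tamagawa number `c_w` is needed at the
additive places. [cite: GreenbergLNM1716, §2, p. 74] [cite: SilvermanAEC2009, Thm. VII.6.1] -/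
theorem exists_mem_unramifiedSubgroup_not_mem_kummerLocalConditionAt_of_hasAdditiveReductionAt_of_point
    (hpv : ((p : ℕ) : 𝓞 K) ∉ v.asIdeal) (hp2 : p ≠ 2) (hadd : W.HasAdditiveReductionAt v)
    {T : (W.baseChange (v.adicCompletion K)).toAffine.Point} (hT : T ≠ 0) (hpT : (p : ℤ) • T = 0) :
    ∃ u ∈ DiscreteGaloisModule.unramifiedSubgroup
        (GaloisRep.restrictField (v.adicCompletion K) (W.torsionGaloisModule (p : ℤ))) 1,
      u ∉ W.kummerLocalConditionAt (p : ℤ) (v.adicCompletion K) :=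
  exists_mem_unramifiedSubgroup_not_mem_kummerLocalConditionAt_of_inertia_torsion_of_point W p v hpv
    (inertia_torsion_of_hasAdditiveReductionAt W p v hpv hp2 hadd) hT hpT

/-- **THE ADDITIVE TAMAGAWA WITNESS.** For an elliptic curve `E` over a number field `K`, an odd
prime `p` and a finite place `v ∤ p` of ADDITIVE reduction whose Tamagawa factor
`c_v = [E(K_v) : E₀(K_v)]` is divisible by `p`: there is an UNRAMIFIED class
`u ∈ H¹_ur(K_v, E[p])` which is NOT in the local Kummer condition `𝓚_v` — the per-prime witness
`∃ u ∈ H¹_ur(K_v, E[p]), u ∉ 𝓚_v` of the level-`0` / level-`n` Route-G budget doors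
(T-E3g-BUD0 FILE 4, T-E3g-BUDn) at the additive Tamagawa places (Kodaira IV / IV*, `p = 3 = c_v`).
FILE A (mechanism) + FILE B (`E(K_v^nr)[p^∞]` killed by `p`) + FILE C (`E(K_v)[p] ≠ 0`).
[cite: GreenbergLNM1716, §2, p. 74] [cite: SilvermanAEC2009, Thm. VII.6.1 and Prop. VII.6.3]
[cite: MilneADT2006, Ch. I §2 Lemma 2.9, §3 Lemma 3.3 and Prop. 3.8] -/
theorem exists_mem_unramifiedSubgroup_not_mem_kummerLocalConditionAt_of_hasAdditiveReductionAt
    (hpv : ((p : ℕ) : 𝓞 K) ∉ v.asIdeal) (hp2 : p ≠ 2) (hadd : W.HasAdditiveReductionAt v)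
    (hc : p ∣ (W.baseChange (v.adicCompletion K)).localTamagawaNumber (v.adicCompletionIntegers K)) :
    ∃ u ∈ DiscreteGaloisModule.unramifiedSubgroup
        (GaloisRep.restrictField (v.adicCompletion K) (W.torsionGaloisModule (p : ℤ))) 1,
      u ∉ W.kummerLocalConditionAt (p : ℤ) (v.adicCompletion K) := by
  obtain ⟨T, hT, hpT⟩ :=
    exists_point_ne_zero_zsmul_eq_zero_of_dvd_localTamagawaNumber W p v hpv hc
  exact exists_mem_unramifiedSubgroup_not_mem_kummerLocalConditionAt_of_inertia_torsion_of_point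
    W p v hpv (inertia_torsion_of_hasAdditiveReductionAt W p v hpv hp2 hadd) hT hpT

end Summit.BirchSwinnertonDyer.Rank1Residual.Additive

end
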